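import Literature.NumberTheory.EllipticCurves.KrizLi2019.TwoPartBSDTwists
import Literature.NumberTheory.EllipticCurves.Zhai2021.TwoAdicLowerBoundTwists
import Literature.NumberTheory.EllipticCurves.Curve37aRootNumber
import HarnessLib

/-!
# Kriz–Li 2019 (FMS 7, e15), §6 Table 1 («Assumption (★) for rank one curves») — the rows `37a1` and `43a1` AS PRINTED:
# for the optimal curves `E = 37a1`, `E = 43a1` and `K = ℚ(√−7)`, Assumption (★) holds (statement-only named facts; the per-curve inputs of
# Thm 5.1 (2) = `thm112_bsdTwo_twist` at the two RANK-ONE rows of PRIME conductor with `d_K = −7`, `c₂(E) = 1` and `49·N < 5000`)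

HONEST FRAMING (cell `bsd-f1-sign2`, seat `bsd-line-gk2-p2` g34, crux U₂ `MinimalTwinBSDTwo` stmt-BirchSwinnertonDyer-22985, LINE 23
«twin_swap»; 2026-08-31): two PUBLISHED per-curve computational assertions (check-marks in a table of a refereed paper) vendored as named
`Prop`s — nothing asserted, nothing discharged (D-0014) — with a locator into the held source; companions of `KrizLi2019.table1_row92b1`
(`Table1RankOneRow92b1.lean`, seat `bsd-2adic-k4-w2`: the only rank-one row ADDITIVE at `2` with `49·N < 5000`) and of
`KrizLi2019.table1_row243a1` (the CM row), in the SAME shape (the optimal parametrisation datum is transcribed because Example 6.2 searches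
«rank one OPTIMAL elliptic curves»; for `37a1`/`43a1`, both GOOD at `2`, Thm 5.1 (2) needs no Manin-constant input, so consumers may ignore
the optimality conjunct).  For a RANK-ONE base `E` the Kriz–Li family `{E^{(d)} : d ∈ 𝒩, χ_d(−N) = 1}` consists of rank-one curves and the
companions `{E^{(−7d)}}` are rank zero; with `N ∈ {37, 43}` the companion base `E^{(−7)}` has conductor `49·N ∈ {1813, 2107} < 5000`, so
BOTH numerical `BSD(2)` inputs of Thm 5.1 (2) are in Creutz–Miller's range — these two rows and `92b1` are the only rank-one rows of Table 1
with `c₂(E)` odd and `d_K² · N < 5000`.  Everything else about the rows (`E(ℚ)[2] = 0`, a point of infinite order, the Heegner hypothesis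
for `(N, −7)`, `c₂ = 1`, the conductors) is decided IN THE KERNEL by the consumer or taken BY NAME from print.  Nothing is booked here; BSD
is not proved by any of this.

Source. D. Kriz, C. Li, *Goldfeld's conjecture and congruences between Heegner points*, Forum Math. Sigma **7** (2019), e15,
doi:10.1017/fms.2019.9 [KrizLi2019] = arXiv:1606.03172 (§§1–6). Texts read: the held chunk text `paper:doi-10-1017-fms-2019-9` (p0017
L21: Example 6.2), which DROPS the table body; the table itself was read in the arXiv v3 source `Congruence.tex` (copy at
`run/shared/lean/pub/bsd-print-cf2/lit/krizli2019/arXiv-1606.03172v3-Congruence.tex`), ll. 964–1017 (`\label{tab:1}`, Example 6.2), rows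
at lines 971 (`37a1 & -7 & 1 & \checkmark`) and 972 (`43a1 & -7 & 1 & \checkmark`).

## The printed statement (verbatim)

* Example 6.2 (tex l. 965): "As discussed in §4, a necessary condition for (★) is that the local Tamagawa numbers `c_p(E)` are all odd
  for `p ≠ 2`. Another necessary condition is that the formal group of `E` at 2 cannot be isomorphic to `𝔾_m` … We search for rank one
  optimal elliptic curves with `E(ℚ)[2] = 0` satisfying these two necessary conditions. There are 38 such curves of conductor `≤ 300`.
  For each curve, we choose `K` with smallest `|d_K|` satisfying the Heegner hypothesis for `N` and such that `2` is split in `K`. Then 31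
  out of 38 curves satisfy (★). See Table 1. The first three columns list `E`, `d_K` and the local Tamagawa number `c₂(E)` at `2`
  respectively. A check-mark in the last column means that (★) holds … If `c₂(E)` is further odd (true for 23 out of 31), then the
  application to BSD(2) (Theorem 5.1) also applies."
* Table 1, caption "Assumption (★) for rank one curves", header `E | d_K | c₂(E) | ★`, first rows (tex ll. 971–976):
  "**`37a1 & -7 & 1 & ✓`**", "**`43a1 & -7 & 1 & ✓`**", "`88a1 & -7 & 4 & ✓`", "`91a1 & -55 & 1 & ✓`", "`91b1 & -55 & 1 & ✓`",
  "`92b1 & -7 & 3 & ✓`", ….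

## Transcription (tree dictionary of `KrizLi2019/TwoPartBSDTwists.lean`)

`E = 37a1` = Cremona's globally minimal model `y² + y = x³ − x` = the tree's `Curve37a.E = [0, 0, 1, −1, 0]` (`Δ = 37`, `N = 37`,
Cremona 1992 Table 1 «37 A1»); `E = 43a1` = Cremona's globally minimal model `y² + y = x³ + x²` = `[0, 1, 1, 0, 0]` (`Δ = −43`, `N = 43`,
Cremona Table 1 «43 A1»).  "`K = ℚ(√−7)`" = any `K` with `IsImaginaryQuadratic K` and `NumberField.discr K = −7`.  "Optimal curve with
its parametrisation" = a datum `Dt : ModularParametrizationData E N` at the conductor level (`NeZero` witness packed) with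
`Zhai2021.IsOptimalDatum E Dt`; "(★) holds" = a Heegner datum `H`, an embedding `ι`, a point `P ∈ E(K)` mapping to `heegnerPointComplex Dt H`,
and `j : K →ₐ[ℚ] ℚ₂` with `AssumptionStar E Dt K P j` — the binders of `thm112_bsdTwo_twist` / `thm33_rank_twist`.  Global minimality of
the printed model is a binder `[IsGloballyMinimal]`.  "Rank one", "`E(ℚ)[2] = 0`", "`c₂(E) = 1`" are NOT transcribed (kernel-side in the
consumer).  Nothing weaker or stronger is transcribed; no `_holds` is expected.  Status: PUB (refereed); per-curve computational TABLE
entries, flag word for the referee: TABLE.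

## References
* [KrizLi2019] §6 Example 6.2 and Table 1 (rows 37a1, 43a1) (FMS chunk p0017 L21; arXiv:1606.03172v3 `Congruence.tex` ll. 965, 971–972);
  Assumption (★) (arXiv p0003 L45–L48); Thm 5.1 (2) = arXiv Thm 1.12.
* [CremonaAlgorithms1997] Table 1 (curves 37A1 = `[0,0,1,−1,0]`, 43A1 = `[0,1,1,0,0]`).
* [Zhai2021BSDExactFormulaTwists] §1 (the optimality predicate `IsOptimalDatum`).
-/

noncomputable section

open scoped Classical

open NumberField WeierstrassCurve Literature.NumberTheory.EllipticCurves
  Literature.NumberTheory.EllipticCurves.ModularForms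

namespace Literature.NumberTheory.EllipticCurves.KrizLi2019

/-- **Kriz–Li 2019, §6 Table 1, row `37a1`** (verbatim in the module docstring: `37a1 | d_K = −7 | c₂(E) = 1 | ★ ✓`; Example 6.2 "rank
one optimal curves … `K` with smallest `|d_K|`"): for every imaginary quadratic field `K` of discriminant `−7`, the optimal curve `37a1` on
its (globally minimal) model `Curve37a.E = [0,0,1,−1,0]` admits an OPTIMAL modular parametrisation datum `Dt` at level `N(E)`, a Heegner
datum `H` of discriminant `d_K` and level `N(E)`, an embedding `ι : K → ℂ`, a point `P ∈ E(K)` mapping to `heegnerPointComplex Dt H`, and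
`j : K → ℚ₂` with Assumption (★) `AssumptionStar E Dt K P j`.  Statement only; TABLE entry in a refereed paper; no `_holds` expected.
[cite: KrizLi2019, §6 Table 1 (row 37a1) and Example 6.2 (FMS 7 (2019) e15, chunk p0017 L21; arXiv:1606.03172v3 Congruence.tex ll. 965, 971)] -/
def table1_row37a1 : Prop :=
  ∀ [Curve37a.E.IsGloballyMinimal]
    (K : Type) [Field K] [NumberField K], IsImaginaryQuadratic K → NumberField.discr K = -7 →
    ∃ (_ : NeZero (Curve37a.E.conductorNorm ℤ))
      (Dt : ModularParametrizationData Curve37a.E (Curve37a.E.conductorNorm ℤ))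
      (H : HeegnerDatum (Curve37a.E.conductorNorm ℤ) (NumberField.discr K))
      (ι : K →+* ℂ) (P : (Curve37a.E.baseChange K).toAffine.Point) (j : K →ₐ[ℚ] ℚ_[2]),
      Zhai2021.IsOptimalDatum Curve37a.E Dt ∧
        WeierstrassCurve.Affine.Point.map ι.toRatAlgHom P = heegnerPointComplex Dt H ∧
          AssumptionStar Curve37a.E Dt K P j

/-- **Kriz–Li 2019, §6 Table 1, row `43a1`** (verbatim in the module docstring: `43a1 | d_K = −7 | c₂(E) = 1 | ★ ✓`; Example 6.2): for every
imaginary quadratic field `K` of discriminant `−7`, the optimal curve `43a1` on its (globally minimal) model `[0,1,1,0,0]` (`y² + y = x³ + x²`)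
admits an OPTIMAL modular parametrisation datum `Dt` at level `N(E)`, a Heegner datum `H` of discriminant `d_K` and level `N(E)`, an
embedding `ι : K → ℂ`, a point `P ∈ E(K)` mapping to `heegnerPointComplex Dt H`, and `j : K → ℚ₂` with `AssumptionStar E Dt K P j`.
Statement only; TABLE entry in a refereed paper; no `_holds` expected.
[cite: KrizLi2019, §6 Table 1 (row 43a1) and Example 6.2 (FMS 7 (2019) e15, chunk p0017 L21; arXiv:1606.03172v3 Congruence.tex ll. 965, 972)] -/
def table1_row43a1 : Prop :=
  ∀ [(⟨0, 1, 1, 0, 0⟩ : WeierstrassCurve ℚ).IsGloballyMinimal]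
    (K : Type) [Field K] [NumberField K], IsImaginaryQuadratic K → NumberField.discr K = -7 →
    ∃ (_ : NeZero ((⟨0, 1, 1, 0, 0⟩ : WeierstrassCurve ℚ).conductorNorm ℤ))
      (Dt : ModularParametrizationData (⟨0, 1, 1, 0, 0⟩ : WeierstrassCurve ℚ)
        ((⟨0, 1, 1, 0, 0⟩ : WeierstrassCurve ℚ).conductorNorm ℤ))
      (H : HeegnerDatum ((⟨0, 1, 1, 0, 0⟩ : WeierstrassCurve ℚ).conductorNorm ℤ) (NumberField.discr K))
      (ι : K →+* ℂ) (P : ((⟨0, 1, 1, 0, 0⟩ : WeierstrassCurve ℚ).baseChange K).toAffine.Point)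
      (j : K →ₐ[ℚ] ℚ_[2]),
      Zhai2021.IsOptimalDatum (⟨0, 1, 1, 0, 0⟩ : WeierstrassCurve ℚ) Dt ∧
        WeierstrassCurve.Affine.Point.map ι.toRatAlgHom P = heegnerPointComplex Dt H ∧
          AssumptionStar (⟨0, 1, 1, 0, 0⟩ : WeierstrassCurve ℚ) Dt K P j

end Literature.NumberTheory.EllipticCurves.KrizLi2019

end
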